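import Summits.HodgeConjecture.HodgeConjecture.Theorems.F0P3SpectralPacketHomogeneous            -- (N) FILE 3w (this seat): `HomogPacketG`, `XiPacketsSignedHom`, `piXiHm`, `XiRigidityGHom`, `tsum_germ_eq_half_mul_piXiHm` (+ ★ 3v Q-generic cores, ★ 3s∕3q∕3r∕3f∕3h)
import Summits.HodgeConjecture.HodgeConjecture.Theorems.F0P3SpectralPacketXiGermSums             -- ★ (N) FILE 3t p843950: `XiRigidityH`, `tsum_germ_eq_rhoXiS` ((L3)+(t3)(t4) stand, n380-2)
import Summits.HodgeConjecture.HodgeConjecture.Theorems.F0P3XiSideOfRecordSCD                  -- ★ `xiSideOfRecordSCD`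
import Summits.HodgeConjecture.HodgeConjecture.Theorems.F0P3bLocalExpansionAtKitOfRecord         -- ★ `GTraceProductForm`
import Summits.HodgeConjecture.HodgeConjecture.Theorems.F0P3GHSideOfFibres                     -- ★ `ghOfFibres`
import Summits.HodgeConjecture.HodgeConjecture.Theorems.F0P3InnerFormClassificationV8          -- ★ v8 `ClassificationKit.APacketSpectral 𝔠 S₀`
import HarnessLib

/-!
# (N) DEFS, FILE 3w′ — (P3′)-G AND (P2) OF LETTER K9-STF BY NAME AT THE HOMOGENEOUS COHERENT TUPLE `PG := HomogPacketG 𝔩 𝔞 μ infOf aTok` (o384-1 repair; supersedes ★ 3v′ for the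
# TUPLE junction) (Rogawski §13.2 p. 200 l. 1–3; §13.3 p. 201 ll. 16–18, Thm. 13.3.5, Thm. 13.3.6 (c), Thm. 13.3.7 pp. 202–203; §13.7 p. 206; §14.4 Prop. 14.4.1 (a) p. 235; §14.6 (14.6.2)–(14.6.3) pp. 241–244)

Cell `hodgecm-mathlib` (D-0151), F0∕P3 «U3-mult», crux H413 (`stmt-HodgeConjecture-24833`), route of record `HCCMUnconditional`.  (N) lead pen F0P3a-p01 (g13); ref1 (g9) R1-384 ∕ REF1 (g22) m08
o384-1; desk F0P3-plan (g9) RULING D33 (3′).  PROOF LANE: two theorems, 0 definitions, no instance, no notation, no named fact, no `sorry`; `--supports stmt-HodgeConjecture-24833 --as helper`.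
HONEST LABEL: HC_CM is proved only modulo the printed citations until rung 0 closes; this file proves no printed statement — it discharges clauses (P3′)-G (`GTraceProductForm`) and (P2)
(`APacketSpectral`) of `K9SpectralLetterSigned` AT THE HOMOGENEOUS COHERENT (N) TUPLE (`PG := HomogPacketG …`, slots through `.1` — the SAME slot texts as ★ 3v′), BY NAME at the letter's own
`ghOfFibres`∕`kitOfRecord`∕`xiSideOfRecordSCD` terms, from: the A-marked coherent signed shape `hXiSH : XiPacketsSignedHom …` (3w), the `H`-shape `hXiHS` (★ 3r), the rigidity (L1″) `XiRigidityGHom`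
(3w: Thm. 13.3.5 + 13.3.6 (c) on the homogeneous coherent packets — the o384-1 hybrids are not in the index type) and (L3) `XiRigidityH` (★ 3t, n380-2), the multiplicity values, (ℓ4), (ℓ9), `hψK`
off `S₀`, the record facts, and the junction identities `hκ`∕`hPi`∕`hPk`.  Proofs = ★ 3v′'s with `piXiC ↦ piXiHm`.

References: [Rogawski1990] §13.2 p. 200 l. 1–3; §13.3 p. 201 ll. 16–18, Thm. 13.3.5 p. 202, Thm. 13.3.6 (c) p. 202, Thm. 13.3.7 pp. 202–203, p. 199 ¶2; §13.7 p. 206; §12.2 p. 174 l. 1; §14.4 Prop. 14.4.1 (a) p. 235; §14.6 (14.6.2)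
p. 241, (14.6.3) p. 243, p. 244 ll. 6–17.  [CartierCorvallis1979] §IV.1 Cor. 4.1.
-/

set_option autoImplicit false
-- the mandated namespace repeats `HodgeConjecture.HodgeConjecture`, as in every `Theorems/*.lean` of this sub-problem
set_option linter.dupNamespace false

noncomputable section

open NumberField IsDedekindDomain MeasureTheory
open scoped Matrix MatrixGroups

open Literature.NumberTheory Literature.NumberTheory.Automorphic Literature.NumberTheory.Automorphic.UnitaryGroup
open Literature.NumberTheory.Rogawski1990 Literature.NumberTheory.GaloisRepresentations
open Literature.RepresentationTheory.BorelWallach2000 Literature.RepresentationTheory.KonnoKonno2007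
open Summit.HodgeConjecture.HodgeConjecture.Cruxes.H413.F0P3InnerFormClassificationV6
open Summit.HodgeConjecture.HodgeConjecture.Cruxes.H413.F0P3InnerFormClassificationV6.ClassificationKit (memberCoeff)
open Summit.HodgeConjecture.HodgeConjecture.Cruxes.H413.F0P3LocalPacketKit
open Summit.HodgeConjecture.HodgeConjecture.Cruxes.H413.F0P3ArchPacketKit
open Summit.HodgeConjecture.HodgeConjecture.Cruxes.H413.F0P3SemilocalTestFunctionsOfRecord (TestS₀ tens₀)
open Summit.HodgeConjecture.HodgeConjecture.Cruxes.H413.F0P3TestFunctionsOfRecord (Unr₀)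
open Summit.HodgeConjecture.HodgeConjecture.Cruxes.H413.F0P3KitOfRecord (GHSide XiSide cptXi₀ kitOfRecord)
open Summit.HodgeConjecture.HodgeConjecture.Cruxes.H413.F0P3XiArchDataOfRecord (nCompactOfRecord)
open Summit.HodgeConjecture.HodgeConjecture.Cruxes.H413.F0P3XiArchPacketOfRecord (archPacketOfRecord)
open Summit.HodgeConjecture.HodgeConjecture.Cruxes.H413.F0P3GHSideOfFibres (ghOfFibres)
open Summit.HodgeConjecture.HodgeConjecture.Cruxes.H413.F0P3bLocalExpansionAtKitOfRecord (GTraceProductForm)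
open Summit.HodgeConjecture.HodgeConjecture.Cruxes.H413.F0P3XiPacketFamilyOfRecord
open Summit.HodgeConjecture.HodgeConjecture.Cruxes.H413.F0P3XiPacketFamilyOfRecordSCD
open Summit.HodgeConjecture.HodgeConjecture.Cruxes.H413.F0P3XiSideOfRecordSCD (xiSideOfRecordSCD)

namespace Summit.HodgeConjecture.HodgeConjecture.Cruxes.H413.F0P3SpectralPacket.SpectralPacketG

open Summit.HodgeConjecture.HodgeConjecture.Cruxes.H413.F0P3GlobalPacket

variable {L : Type} [Field L] [NumberField L] [IsCMField L] {H : Matrix (Fin 3) (Fin 3) L} {ι : L →+* ℂ} {T : GL (Fin 3) ℂ}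
  {hT : (T : Matrix (Fin 3) (Fin 3) ℂ)ᴴ * H.map ι * (T : Matrix (Fin 3) (Fin 3) ℂ) = Literature.Geometry.ComplexHyperbolic.BallModel.J}
  {𝔩 : ∀ v : HeightOneSpectrum (𝓞 ↥(maximalRealSubfield L)), LocalPacketKit L (splitForm L 3) v} {𝔞 : ArchPacketKit}
  {μ : Measure (adelicGroupData (↥(maximalRealSubfield L)) L (IsCMField.complexConj L) 3 (splitForm L 3)).automorphicQuotient}
  [SMulInvariantMeasure (adelicGroupData (↥(maximalRealSubfield L)) L (IsCMField.complexConj L) 3 (splitForm L 3)).Adelic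
    (adelicGroupData (↥(maximalRealSubfield L)) L (IsCMField.complexConj L) 3 (splitForm L 3)).automorphicQuotient μ]
  [∀ v : HeightOneSpectrum (𝓞 ↥(maximalRealSubfield L)), MeasurableSpace ((cmDatum L 3 (splitForm L 3)).Local v)]
  [∀ v : HeightOneSpectrum (𝓞 ↥(maximalRealSubfield L)), BorelSpace ((cmDatum L 3 (splitForm L 3)).Local v)]
  -- the `G′`-side sockets other than `PacketG` (the letter's `𝔰 := ⟨𝔨.traceGp, 𝔨.Smooth, PG, PH, nG, nH, trG, trH, 𝔨.Matches⟩`)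
  {μGp : Measure (Gp L H).automorphicQuotient} [(Gp L H).IsAutomorphicMeasure μGp]
  {infOf : GlobalPacket 𝔩 → 𝔞.PktInf} {aTok : ∀ v : HeightOneSpectrum (𝓞 ↥(maximalRealSubfield L)), Set (𝔩 v).Pkt}
  {traceGp : TestGp L H →ₗ[ℂ] ℂ} {Smooth : TestGp L H → Prop} {PH : Type} {nG : HomogPacketG 𝔩 𝔞 μ infOf aTok → ℂ} {nH : PH → ℂ}
  {trG : HomogPacketG 𝔩 𝔞 μ infOf aTok → TestG L → ℂ} {trH : PH → TestH L → ℂ} {Matches : TestGp L H → TestG L → TestH L → Prop}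
  {Pk' : OneDimAutRepH L → ∀ v : HeightOneSpectrum (𝓞 ↥(maximalRealSubfield L)), CMLocalAPacket L H v} {κ : OneDimAutRepH L → ℤ}

open scoped Classical in
/-- **(w5) (P3′)-G OF LETTER K9-STF AT THE HOMOGENEOUS COHERENT TUPLE, BY NAME** (★ 3v′ re-cut at `PG := HomogPacketG …`, slots through `.1`).  For the letter's `gh := ghOfFibres ι T hT 𝔰 hg hsm trGS trHS` with the (N) slot `trGS S Q f′_S := Q.trSψ ψ S (ψ_* νG) archTr f′_S`,
a ξ-side `ξd` reading `PiXi := piXiHm hXiS` and `packFin := Pk′`, archimedean A-packets `archPacketOfRecord ι μω jInf dsInf`, and the signed scalar `κ ξ = (−1)^N · [cptXi₀ ι μω ξ]`: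
`GTraceProductForm ι T hT gh ξd μω jInf dsInf archTr νG` — «`Tr Π(ξ)_S(f_{S,G}) = [cptXi₀ ξ] · (−1)^N · (A πⁿ_ι − A πˢ_ι) · ∏_{v ∈ S} (Tr πⁿ_v − Tr πˢ_v)(f′_v)`» [13.1.3 (b); 12.3.3 (b); Prop. 14.4.1 (a);
p. 244 ll. 6–17] — modulo ONE kit law (member admissibility of `Π(ξ)_v`, `hadm`).  Proof: `MatchesS ↔ fSG = fS` (★ `ghOfFibres`), then ★ FILE 3q `trSψ_piXiS_eq`.
[cite: Rogawski1990, §13.2 p. 200 l. 1–3; §13.1 Prop. 13.1.3 (b)(d) p. 199; §12.3 Prop. 12.3.3 p. 178; §14.4 Prop. 14.4.1 (a) p. 235; §14.6 p. 243, p. 244 ll. 6–17] -/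
theorem gTraceProductForm_ghOfFibres_hom
    (ψ : ∀ v : HeightOneSpectrum (𝓞 ↥(maximalRealSubfield L)), (cmDatum L 3 H).Local v ≃ₜ* (cmDatum L 3 (splitForm L 3)).Local v)
    (νG : ∀ v : HeightOneSpectrum (𝓞 ↥(maximalRealSubfield L)), @Measure ((cmDatum L 3 H).Local v) (borel _))
    (hνl : ∀ v : HeightOneSpectrum (𝓞 ↥(maximalRealSubfield L)), letI : MeasurableSpace ((cmDatum L 3 H).Local v) := borel _; (νG v).IsMulLeftInvariant)
    (hνc : ∀ v : HeightOneSpectrum (𝓞 ↥(maximalRealSubfield L)), letI : MeasurableSpace ((cmDatum L 3 H).Local v) := borel _; IsFiniteMeasureOnCompacts (νG v))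
    (μω : HeckeCharacter L) (jInf dsInf : ℤ → ℤ → ℤ → GKIrrClass (uFormGroup (Fin 2) (Fin 1)))
    (archTr : GKIrrClass (uFormGroup (Fin 2) (Fin 1)) → (UnitaryGroup.arch (↥(maximalRealSubfield L)) L (IsCMField.complexConj L) 3 H → ℂ) → ℂ)
    (hXiS : XiPacketsSignedHom 𝔩 𝔞 μ infOf aTok (transportAPackets ψ Pk') (archPacketOfRecord ι μω jInf dsInf) κ)
    (hadm : ∀ (ξ : OneDimAutRepH L) (v : HeightOneSpectrum (𝓞 ↥(maximalRealSubfield L))), ∀ π ∈ (𝔩 v).mem ((piXiHm hXiS ξ).1.fin.loc v), π.IsAdmissible)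
    (hκ : ∀ ξ : OneDimAutRepH L, (κ ξ : ℂ) = (if cptXi₀ ι μω ξ then 1 else 0) * (-1) ^ nCompactOfRecord L)
    (hg : ∀ f' : TestGp L H, Smooth f' → ∃ (f : TestG L) (fH : TestH L), Matches f' f fH)
    (hsm : ∀ (S : Finset (Places L)) (fS : TestS₀ L H ι T hT S) (fT : Unr₀ L H S), Smooth (tens₀ S fS fT))
    (trHS : ∀ S : Finset (Places L), PH → TestS₀ L H ι T hT S → ℂ)
    (ξd : XiSide L H (HomogPacketG 𝔩 𝔞 μ infOf aTok) PH) (hPi : ∀ ξ : OneDimAutRepH L, ξd.PiXi ξ = piXiHm hXiS ξ)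
    (hPk : ∀ (ξ : OneDimAutRepH L) (v : HeightOneSpectrum (𝓞 ↥(maximalRealSubfield L))), ξd.packFin ξ v = Pk' ξ v) :
    GTraceProductForm ι T hT
      (ghOfFibres ι T hT (⟨traceGp, Smooth, HomogPacketG 𝔩 𝔞 μ infOf aTok, PH, nG, nH, trG, trH, Matches⟩ : Sockets L H μGp) hg hsm
        (fun S Q fS => Q.1.trSψ ψ S (fun v => @Measure.map _ _ (borel _) _ (ψ v) (νG v)) archTr fS) trHS)
      ξd μω jInf dsInf archTr νG := by
  letI : ∀ v : HeightOneSpectrum (𝓞 ↥(maximalRealSubfield L)), MeasurableSpace ((cmDatum L 3 H).Local v) := fun _ => borel _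
  haveI : ∀ v : HeightOneSpectrum (𝓞 ↥(maximalRealSubfield L)), BorelSpace ((cmDatum L 3 H).Local v) := fun _ => ⟨rfl⟩
  haveI : ∀ v : HeightOneSpectrum (𝓞 ↥(maximalRealSubfield L)), (νG v).IsMulLeftInvariant := hνl
  haveI : ∀ v : HeightOneSpectrum (𝓞 ↥(maximalRealSubfield L)), IsFiniteMeasureOnCompacts (νG v) := hνc
  intro ξ S _ fS fSG fSH hm
  obtain ⟨hfS, -⟩ := hm
  rw [hfS]
  change (ξd.PiXi ξ).1.trSψ ψ S (fun v => @Measure.map _ _ (borel _) _ (ψ v) (νG v)) archTr fS = _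
  rw [hPi ξ, (piXiHm_isSignedPacketOf hXiS ξ).trSψ_eq_mul_finsum (Pk' := Pk' ξ) (hadm ξ) S fS archTr, hκ ξ]
  simp only [hPk ξ, mul_assoc]

end Summit.HodgeConjecture.HodgeConjecture.Cruxes.H413.F0P3SpectralPacket.SpectralPacketG

namespace Summit.HodgeConjecture.HodgeConjecture.Cruxes.H413.F0P3SpectralPacket

open Summit.HodgeConjecture.HodgeConjecture.Cruxes.H413.F0P3GlobalPacket

variable (L : Type) [Field L] [NumberField L] [IsCMField L] (H : Matrix (Fin 3) (Fin 3) L)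
  -- the binders of the ξ-local family of record (★ `xiSideOfRecordSCD` §1, VERBATIM)
  (hH : (H.map (cmConjRingHom L))ᵀ = H) (hHd : IsUnit H.det) (μω : HeckeCharacter L) (hμu : μω.IsUnitary)
  [∀ v : HeightOneSpectrum (𝓞 ↥(maximalRealSubfield L)), MeasurableSpace (Gqs L v ⧸ Subgroup.center (Gqs L v))]
  (μZ : ∀ v : HeightOneSpectrum (𝓞 ↥(maximalRealSubfield L)), Measure (Gqs L v ⧸ Subgroup.center (Gqs L v)))
  (keys : ∀ (ξ : OneDimAutRepH L) (v : HeightOneSpectrum (𝓞 ↥(maximalRealSubfield L))),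
    (∀ w : PlacesOver L v, IsCMField.complexConj L • w.1 = w.1) →
      {p : IrrClass (Gqs L v) × IrrClass (Gqs L v) //
        KeysCaseTwoLabels L v (μω.semilocalComponent L v) (torusLocalComponent L (IsCMField.complexConj L) v ξ.η)
          (torusLocalComponent L (IsCMField.complexConj L) v ξ.ψ) p.1 p.2 ∧
        p.1.IsSquareIntegrable (μZ v) ∧ ¬ p.2.IsSquareIntegrable (μZ v)})
  (hSC : letI : ∀ v : HeightOneSpectrum (𝓞 ↥(maximalRealSubfield L)), MeasurableSpace ((cmDatum L 3 H).Local v) := fun _ => borel _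
    ∀ (ξ : OneDimAutRepH L) (v : HeightOneSpectrum (𝓞 ↥(maximalRealSubfield L)))
    (hns : ∀ w : PlacesOver L v, IsCMField.complexConj L • w.1 = w.1)
    (T : GL (Fin 3) (LocalRing L v)) (a : LocalRing L v) (ha : IsUnit a)
    (h : formCongr (conjLocal L (IsCMField.complexConj L) v) T (H.map (algebraMap L (LocalRing L v))) =
      a • (Matrix.of fun i j : Fin 3 => if i.val + j.val + 1 = 3 then (1 : L) else 0).map (algebraMap L (LocalRing L v)))
    (π2 πn : IrrClass (Gqs L v)),
    KeysCaseTwoLabels L v (μω.semilocalComponent L v) (torusLocalComponent L (IsCMField.complexConj L) v ξ.η)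
      (torusLocalComponent L (IsCMField.complexConj L) v ξ.ψ) π2 πn → ¬ πn.IsSquareIntegrable (μZ v) →
    {πs : IrrClass ((cmDatum L 3 H).Local v) // πs.IsSupercuspidal ∧ πs ≠ IrrClass.comap (cmDatumLocalCongr L v T ha h).symm πn})
  (hexc : ∀ ξ : OneDimAutRepH L, ∀ᶠ v : HeightOneSpectrum (𝓞 ↥(maximalRealSubfield L)) in Filter.cofinite,
      ∀ hns : ∀ w : PlacesOver L v, IsCMField.complexConj L • w.1 = w.1,
        ((keys ξ v hns).1.2).IsSpherical (cmLocalIntegralLevel L 3 (qsForm L) v))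

  -- the frame, T1's sockets other than the packet types, and `kitOfRecord`'s remaining parameters
  (ι : L →+* ℂ) (T : GL (Fin 3) ℂ)
  (hT : (T : Matrix (Fin 3) (Fin 3) ℂ)ᴴ * H.map ι * (T : Matrix (Fin 3) (Fin 3) ℂ) = Literature.Geometry.ComplexHyperbolic.BallModel.J)
  (μGp : Measure (Gp L H).automorphicQuotient) [(Gp L H).IsAutomorphicMeasure μGp] [MeasurableSpace (Gp L H).Adelic] [BorelSpace (Gp L H).Adelic]
  (traceGp : TestGp L H →ₗ[ℂ] ℂ) (Smooth : TestGp L H → Prop) (Matches : TestGp L H → TestG L → TestH L → Prop)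
  (c : ℚ) (jInf dsInf : ℤ → ℤ → ℤ → Cinf)
  (archTr : Cinf → (UnitaryGroup.arch (↥(maximalRealSubfield L)) L (IsCMField.complexConj L) 3 H → ℂ) → ℂ)
  (νA : Measure (Gp L H).Adelic) [IsFiniteMeasureOnCompacts νA]
  (νG : ∀ v : Places L, @Measure ((cmDatum L 3 H).Local v) (borel _))
  (ramCls₀ : DiscreteAutomorphicRep (Gp L H) μGp → Set (Places L))
  -- the (N) kits and slots
  {𝔩 : ∀ v : HeightOneSpectrum (𝓞 ↥(maximalRealSubfield L)), LocalPacketKit L (splitForm L 3) v} {𝔞 : ArchPacketKit} {𝔞H : ArchPacketKitH 𝔞}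
  {DiscH : GlobalPacketH 𝔩 → 𝔞H.PktInfH → Prop}
  {μ : Measure (adelicGroupData (↥(maximalRealSubfield L)) L (IsCMField.complexConj L) 3 (splitForm L 3)).automorphicQuotient}
  [SMulInvariantMeasure (adelicGroupData (↥(maximalRealSubfield L)) L (IsCMField.complexConj L) 3 (splitForm L 3)).Adelic
    (adelicGroupData (↥(maximalRealSubfield L)) L (IsCMField.complexConj L) 3 (splitForm L 3)).automorphicQuotient μ]
  [∀ v : HeightOneSpectrum (𝓞 ↥(maximalRealSubfield L)), MeasurableSpace ((cmDatum L 3 (splitForm L 3)).Local v)]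
  [∀ v : HeightOneSpectrum (𝓞 ↥(maximalRealSubfield L)), BorelSpace ((cmDatum L 3 (splitForm L 3)).Local v)]
  (infOf : GlobalPacket 𝔩 → 𝔞.PktInf) (aTok : ∀ v : HeightOneSpectrum (𝓞 ↥(maximalRealSubfield L)), Set (𝔩 v).Pkt)
  (nG : SpectralPacketG.HomogPacketG 𝔩 𝔞 μ infOf aTok → ℂ) (nH : SpectralPacketH 𝔩 𝔞 𝔞H DiscH → ℂ)
  (trG : SpectralPacketG.HomogPacketG 𝔩 𝔞 μ infOf aTok → TestG L → ℂ) (trH : SpectralPacketH 𝔩 𝔞 𝔞H DiscH → TestH L → ℂ)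
  (trGS : ∀ S : Finset (Places L), SpectralPacketG.HomogPacketG 𝔩 𝔞 μ infOf aTok → TestS₀ L H ι T hT S → ℂ)
  (trHS : ∀ S : Finset (Places L), SpectralPacketH 𝔩 𝔞 𝔞H DiscH → TestS₀ L H ι T hT S → ℂ)
  {ε : OneDimAutRepH L → HeightOneSpectrum (𝓞 ↥(maximalRealSubfield L)) → ℤ} {κH κ : OneDimAutRepH L → ℤ}

open scoped Classical in
/-- **(w6) (P2) OF LETTER K9-STF AT THE HOMOGENEOUS COHERENT TUPLE, BY NAME** (★ 3v′ re-cut at `PG := HomogPacketG …` with the rigidity (L1″) `XiRigidityGHom`, Thm. 13.3.5 + 13.3.6 (c)) — «A-packet spectral data» [Thm. 13.3.5, Thm. 13.3.7; (14.6.2)–(14.6.3)]: for the letter's own kit of record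
`𝔠₀ = kitOfRecord … ⟨traceGp, Smooth, HomogPacketG 𝔩 𝔞 μ infOf aTok, SpectralPacketH 𝔩 𝔞 𝔞H DiscH, nG, nH, trG, trH, Matches⟩ (ghOfFibres … trGS trHS) ξd₀ μω c jInf dsInf archTr νA νG ramCls₀` with the
ξ-side of record `ξd₀ = xiSideOfRecordSCD … νG (evpGψ-slot) (evpHψ-slot) (ramFinset-slot) (ramFinsetH-slot) (piXiHm hXiS) (rhoXiS hXiHS)`, the clause `𝔠₀.APacketSpectral S₀` holds,
modulo: the signed shapes `hXiS`∕`hXiHS` (3w∕★ 3r) on the record `Pk′ := xiPacketFamilyOfRecordSCD …` transported by `ψ`, the rigidity laws (L1″)∕(L3) at `tXi := xiEvpOfRecordSCD … νG` (3w∕★ 3t),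
the multiplicity values `hnG : nG (piXiHm hXiS ξ) = 1∕2`, `hnH : nH (rhoXiS hXiHS ξ) = 1` [Thm. 13.3.7; p. 203; (14.6.3)], (ℓ4) `UnramLaw`, (ℓ9) `UnrDefLaw`, `hψK` off `S₀`, and the record
facts `hsph` («`πⁿ(ξ_v)` is `K′_v`-spherical off `ramOfRecord₂ ξ`», ★ `xiUnram_xiPacketFamilyOfRecordSCD`) and `hadmn` («`πⁿ(ξ_v)` admissible»).
[cite: Rogawski1990, §13.3 Thm. 13.3.5 p. 202, Thm. 13.3.7 pp. 202–203, p. 199 ¶2; §13.7 p. 206; §12.2 p. 174 l. 1; §14.6 (14.6.2) p. 241, (14.6.3) p. 243] [cite: CartierCorvallis1979, §IV.1 Cor. 4.1] -/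
theorem aPacketSpectral_kitOfRecord_hom
    (ψ : ∀ v : HeightOneSpectrum (𝓞 ↥(maximalRealSubfield L)), (cmDatum L 3 H).Local v ≃ₜ* (cmDatum L 3 (splitForm L 3)).Local v)
    (hνl : ∀ v : HeightOneSpectrum (𝓞 ↥(maximalRealSubfield L)), letI : MeasurableSpace ((cmDatum L 3 H).Local v) := borel _; (νG v).IsMulLeftInvariant)
    (hνc : ∀ v : HeightOneSpectrum (𝓞 ↥(maximalRealSubfield L)), letI : MeasurableSpace ((cmDatum L 3 H).Local v) := borel _; IsFiniteMeasureOnCompacts (νG v))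
    (hXiS : SpectralPacketG.XiPacketsSignedHom 𝔩 𝔞 μ infOf aTok
      (transportAPackets ψ (letI : ∀ v : HeightOneSpectrum (𝓞 ↥(maximalRealSubfield L)), MeasurableSpace ((cmDatum L 3 H).Local v) := fun _ => borel _
        xiPacketFamilyOfRecordSCD L H hH hHd μω hμu μZ keys hSC))
      (F0P3XiArchPacketOfRecord.archPacketOfRecord ι μω jInf dsInf) κ)
    (hXiHS : SpectralPacketH.XiHPacketsSigned 𝔩 𝔞 𝔞H DiscH
      (transportAPackets ψ (letI : ∀ v : HeightOneSpectrum (𝓞 ↥(maximalRealSubfield L)), MeasurableSpace ((cmDatum L 3 H).Local v) := fun _ => borel _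
        xiPacketFamilyOfRecordSCD L H hH hHd μω hμu μZ keys hSC))
      (F0P3XiArchPacketOfRecord.archPacketOfRecord ι μω jInf dsInf) (fun ξ v => ξ.xiLocalChar v) (fun ξ v => F0P3XiLocalCharOpenKernel.isOpen_ker_xiLocalChar L ξ v) ε κH)
    (h4 : ∀ v : HeightOneSpectrum (𝓞 ↥(maximalRealSubfield L)), (𝔩 v).UnramLaw) (h9 : ∀ v : HeightOneSpectrum (𝓞 ↥(maximalRealSubfield L)), UnrDefLaw (𝔩 v))
    (S₀ : Finset (HeightOneSpectrum (𝓞 ↥(maximalRealSubfield L))))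
    (hψK : ∀ v ∉ S₀, (cmLocalIntegralLevel L 3 H v).map (ψ v : (cmDatum L 3 H).Local v →* (cmDatum L 3 (splitForm L 3)).Local v) =
      cmLocalIntegralLevel L 3 (splitForm L 3) v)
    (hsph : letI : ∀ v : HeightOneSpectrum (𝓞 ↥(maximalRealSubfield L)), MeasurableSpace ((cmDatum L 3 H).Local v) := fun _ => borel _
      ∀ (ξ : OneDimAutRepH L), ∀ v ∉ ramOfRecord₂ L H hH hHd μω μZ keys ξ (hexc ξ),
        (xiPacketFamilyOfRecordSCD L H hH hHd μω hμu μZ keys hSC ξ v).πn.IsSpherical (cmLocalIntegralLevel L 3 H v))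
    (hadmn : letI : ∀ v : HeightOneSpectrum (𝓞 ↥(maximalRealSubfield L)), MeasurableSpace ((cmDatum L 3 H).Local v) := fun _ => borel _
      ∀ (ξ : OneDimAutRepH L) (v : HeightOneSpectrum (𝓞 ↥(maximalRealSubfield L))), (xiPacketFamilyOfRecordSCD L H hH hHd μω hμu μZ keys hSC ξ v).πn.IsAdmissible)
    (hrigG : SpectralPacketG.XiRigidityGHom hXiS ψ (fun v => @Measure.map _ _ (borel _) _ (ψ v) (νG v))
      (letI : ∀ v : HeightOneSpectrum (𝓞 ↥(maximalRealSubfield L)), MeasurableSpace ((cmDatum L 3 H).Local v) := fun _ => borel _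
       xiEvpOfRecordSCD L H hH hHd μω hμu μZ keys hSC νG))
    (hrigH : SpectralPacketH.XiRigidityH hXiHS ψ (fun v => @Measure.map _ _ (borel _) _ (ψ v) (νG v))
      (letI : ∀ v : HeightOneSpectrum (𝓞 ↥(maximalRealSubfield L)), MeasurableSpace ((cmDatum L 3 H).Local v) := fun _ => borel _
       xiEvpOfRecordSCD L H hH hHd μω hμu μZ keys hSC νG))
    (hnG : ∀ ξ : OneDimAutRepH L, nG (SpectralPacketG.piXiHm hXiS ξ) = 1 / 2) (hnH : ∀ ξ : OneDimAutRepH L, nH (SpectralPacketH.rhoXiS hXiHS ξ) = 1)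
    -- the letter's socket-level `hg`∕`hsm`
    (hg : ∀ f' : TestGp L H, Smooth f' → ∃ (f : TestG L) (fH : TestH L), Matches f' f fH)
    (hsm : ∀ (S : Finset (Places L)) (fS : TestS₀ L H ι T hT S) (fT : Unr₀ L H S), Smooth (tens₀ S fS fT)) :
    F0P3InnerFormClassificationV8.ClassificationKit.APacketSpectral
      (kitOfRecord L H ι T hT μGp (⟨traceGp, Smooth, SpectralPacketG.HomogPacketG 𝔩 𝔞 μ infOf aTok, SpectralPacketH 𝔩 𝔞 𝔞H DiscH, nG, nH, trG, trH, Matches⟩ : Sockets L H μGp)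
        (ghOfFibres ι T hT (⟨traceGp, Smooth, SpectralPacketG.HomogPacketG 𝔩 𝔞 μ infOf aTok, SpectralPacketH 𝔩 𝔞 𝔞H DiscH, nG, nH, trG, trH, Matches⟩ : Sockets L H μGp) hg hsm trGS trHS)
        (xiSideOfRecordSCD L H hH hHd μω hμu μZ keys hSC hexc νG
          (fun Q => Q.1.evpGψ ψ (fun v => @Measure.map _ _ (borel _) _ (ψ v) (νG v)))
          (fun ρ => ρ.evpHψ ψ (fun v => @Measure.map _ _ (borel _) _ (ψ v) (νG v)))
          (fun Q => Q.1.fin.ramFinset) (fun ρ => ρ.ramFinsetH) (SpectralPacketG.piXiHm hXiS) (SpectralPacketH.rhoXiS hXiHS))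
        μω c jInf dsInf archTr νA νG ramCls₀) S₀ := by
  letI : ∀ v : HeightOneSpectrum (𝓞 ↥(maximalRealSubfield L)), MeasurableSpace ((cmDatum L 3 H).Local v) := fun _ => borel _
  haveI : ∀ v : HeightOneSpectrum (𝓞 ↥(maximalRealSubfield L)), BorelSpace ((cmDatum L 3 H).Local v) := fun _ => ⟨rfl⟩
  haveI : ∀ v : HeightOneSpectrum (𝓞 ↥(maximalRealSubfield L)), (νG v).IsMulLeftInvariant := hνl
  haveI : ∀ v : HeightOneSpectrum (𝓞 ↥(maximalRealSubfield L)), IsFiniteMeasureOnCompacts (νG v) := hνc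
  intro ξ S hS₀ hram
  refine ⟨?_, ?_, ?_, ?_, fun fSG fSH => ⟨?_, ?_⟩⟩
  · exact (SpectralPacketG.piXiHm_isSignedPacketOf hXiS ξ).ramFinset_subset (Pk' := fun v => xiPacketFamilyOfRecordSCD L H hH hHd μω hμu μZ keys hSC ξ v)
      h9 S₀ hψK _ (hsph ξ) S hS₀ hram
  · exact SpectralPacketH.ramFinsetH_rhoXiS_subset ψ hXiHS h9 S₀ hψK hsph ξ S hS₀ hram
  · exact fun v hv => (SpectralPacketG.piXiHm_isSignedPacketOf hXiS ξ).evpGψ_eq_of_not_mem (Pk' := fun v => xiPacketFamilyOfRecordSCD L H hH hHd μω hμu μZ keys hSC ξ v)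
      (h4 v) (h9 v) (hψK v fun h => hv (hS₀ h)) (hsph ξ v fun h => hv (hram h)) (hadmn ξ v)
  · exact fun v hv => SpectralPacketH.evpHψ_rhoXiS_eq_of_not_mem ψ hXiHS h4 h9 S₀ hψK hsph hadmn ξ (fun h => hv (hS₀ h)) (fun h => hv (hram h))
  · exact SpectralPacketG.tsum_germ_eq_half_mul_piXiHm hrigG ξ S
      (fun v hv => (SpectralPacketG.piXiHm_isSignedPacketOf hXiS ξ).evpGψ_eq_of_not_mem (Pk' := fun v => xiPacketFamilyOfRecordSCD L H hH hHd μω hμu μZ keys hSC ξ v)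
        (h4 v) (h9 v) (hψK v fun h => hv (hS₀ h)) (hsph ξ v fun h => hv (hram h)) (hadmn ξ v))
      ((SpectralPacketG.piXiHm_isSignedPacketOf hXiS ξ).ramFinset_subset (Pk' := fun v => xiPacketFamilyOfRecordSCD L H hH hHd μω hμu μZ keys hSC ξ v)
        h9 S₀ hψK _ (hsph ξ) S hS₀ hram) _ (hnG ξ) _ fSG
  · exact SpectralPacketH.tsum_germ_eq_rhoXiS hrigH ξ S
      (fun v hv => SpectralPacketH.evpHψ_rhoXiS_eq_of_not_mem ψ hXiHS h4 h9 S₀ hψK hsph hadmn ξ (fun h => hv (hS₀ h)) (fun h => hv (hram h)))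
      (SpectralPacketH.ramFinsetH_rhoXiS_subset ψ hXiHS h9 S₀ hψK hsph ξ S hS₀ hram) _ (hnH ξ) _ fSH

end Summit.HodgeConjecture.HodgeConjecture.Cruxes.H413.F0P3SpectralPacket

end
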